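import Summits.CriticalPhenomena.PercolationContinuityZ3.Theorems.Transplant.SkelFrmBChoiceDefsV
import Summits.CriticalPhenomena.PercolationContinuityZ3.Theorems.Transplant.SkelNeg1ChoiceAll
import HarnessLib

/-!
# N2 (frames-only node `SamePDropOfSkeletonFrm₁`, OPEN), WAVE 1 under (R-44)/(R-45): THE GEOMETRIC OBLIGATION OF THE CHOICE FUNCTION OF RECORD, SECOND CELL PORT —
# `PlanarSkeletonFrm.geomHoldsNQFn_frmChoiceAllQ3V : ∀ gv fv Pv Sv cv hv bv, GeomHoldsNQFn (frmChoiceAllQ3V gv fv Pv Sv cv hv bv)` (1 of the 4 column obligations)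

The (R-45) `…V` twin of `SkelFrmBChoiceGeomT` (p361151, the Geom column at `frmChoiceAllQ3T`), token for token: the same three steps over the V cells of record
`NegB.fcellsV … c hf` (SkelFrmBChoiceCellsV: `PCells2T` + per-axis ASYMMETRIC transverse rooms) and hp-8 g42/g43's V scheme geometry `Skelφ.cellGeomSG₂bV / faceDataSGV /
levelDataSV` (SkelPhiCellsSmallMV / WeakGLevelsV / FineGeomV): the column point over the staggered centre from `Skelφ.hcol_fineSkelV`, the nine `GeomHoldsN` conjuncts from
`runGeomSG₂bV / anchGeomSG₂bV / sepGeom₂SG₂bV / exitGeomSG₂bV / stepsGeomSG₂bV / levelGeomSG₂bV`, and the obligation at the choice function of record `frmChoiceAllQ3V` for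
EVERY slot value (`bOf ≤ 3r` by `bOf_leV`, the column floor at the staggered centre by `colQ_schedOfT` — the schedule `schedOfT` and the column slot `offNT` are T's, the V
cells inherit `cenS/r/s` (`fcellsV_cenS`, `fcellsV_toPCells2T`, by `rfl`) —, `EqNumL` from `FactsNS`).  The fine map is the UNCHANGED (ζ′) map `fineA` / `fineOA`.
* §1 `hcol_fineA_atV`, `hcol_fineA_of_schedV`; §2 **`geom_fineA_at_bV`** (the nine conjuncts, map slot `φ′`, any `b₀ ≤ 3r`, any creep / forward-room values `c hf`);
* §3 **`geomHoldsNQFn_frmChoiceAllQ3V`** — the Geom column obligation AT THE CHOICE FUNCTION OF RECORD under (R-44)/(R-45) (lead g12 11:31:15Z/11:46:03Z: wrappers at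
  `frmChoiceAllQ3V`; the function of record moves to Q3V on DefsV's ACCEPT).
NON-VACUITY (lead g11 standing order 03:52:56Z): an unconditional `∀ slots` theorem — it IS its own witness at every closed slot tuple.
builds on p205010 (kernel theorem, internal audit signed; external expert review pending) — nothing in this file uses p205010; NOTHING is claimed about the open node
`SamePDropOfSkeletonFrm₁` (`SamePDropOfSkeletonNeg₁` is CLOSED in the tree and untouched by this file).
Lane `prim-bschramm`, seat `prim-bschramm-stmt` (gen 22); helper file (`--supports stmt-CriticalPhenomena-4575 --as helper`); rulings (R-31) (slots), (R-33) (cube), (R-40)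
(per-axis cap), (R-44)/(R-45) (asymmetric rooms; design owner p3-g17/g18; V port owner hp-8 g42/g43).
[cite: KozmaNitzan2024, §4 pp. 25–29 (Q_v, M_v, E_{v,x}, H^j_{v,x}; (29): columns)] [cite: MartineauTassion2017, §4.3]
-/

noncomputable section

open scoped Classical

namespace Summit.CriticalPhenomena.PercolationContinuityZ3.Theorems.Transplant

open MeasureTheory Literature.Probability.Percolation Literature.Probability.LatticeModels SimpleGraph KNCells
open Literature.Barriers.CriticalPhenomena (HasExponentialGrowth graphBall)

namespace PlanarSkeletonFrm

open SkelConc (Consts)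
open BoxProdZ2 (ConcRadiiG)
open Skelφ (oriφ trφ)
open Skelφ.StepI (DataN DataNS OutNS)

namespace NegB

open Neg

section Geom

variable (κ : Consts) {V : Type} [DecidableEq V] [Countable V] {G : SimpleGraph V} [G.LocallyFinite] (Φ : PlanarSkeletonFrm G) (t : V)
  (p : unitInterval) (D : DataNS V) (g f : ℕ) (c hf : Fin 2 → ℕ)

/-! ## §1 The column point over the staggered centre (V cells) -/

/-- **THE COLUMN POINT over the STAGGERED centre (V cells)** for the fine map of the (ζ′) chain: for every cube `Q x` of the V cells `fcellsV … c hf` and every radius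
`R ≥ NrepA (cenS x) + 1`, a vertex of fine position exactly `cenS x` inside the window span `VWin (Q x) R`. [cite: KozmaNitzan2024, §4 p. 26 ((29): columns)] -/
theorem hcol_fineA_atV {φ' : V → Site 2} (hlip : Skelφ.Lip G φ') (hstep : Skelφ.Steps G φ') (hN : EqNumL κ Φ t p D g f) (x : Site 2) {R : ℕ}
    (hR : NrepA κ Φ t p D g f ((fcellsV κ Φ t p D g f c hf).cenS x) + 1 ≤ R) :
    ∃ y ∈ Skelφ.VWin G (fineA κ Φ t p D g f φ') t ((fcellsV κ Φ t p D g f c hf).Q x) R, fineA κ Φ t p D g f φ' y = (fcellsV κ Φ t p D g f c hf).cenS x := by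
  obtain ⟨hn1, hℓ1⟩ := one_le_of_eqNumL κ Φ t p D g f hN
  obtain ⟨r0, r1⟩ := room_fcellsA_at κ Φ t p D g f hN
  have hD := Skelφ.NegPrm.DofA_pos (Aof_pos κ).2 hn1 hℓ1 (hL κ Φ t p D g f) (vL κ Φ t p D g f)
  exact Skelφ.hcol_fineSkelV (A := Aof κ) (n := (nL κ Φ t p D g f : ℤ)) (h := hL κ Φ t p D g f) (vα := vL κ Φ t p D g f) (vβ := vβL κ Φ t p D g f) hlip hstep t
    (cA_pos κ Φ t p D g f 0) (cA_pos κ Φ t p D g f 1) hD r0 r1 (fcellsV κ Φ t p D g f c hf) x hR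

/-- **`hcol` in the shape `sepGeomSG₂bV` consumes**, from a schedule whose cube radii dominate the column radius at the staggered centres of the V cells. [folklore] -/
theorem hcol_fineA_of_schedV {φ' : V → Site 2} (hlip : Skelφ.Lip G φ') (hstep : Skelφ.Steps G φ') (hN : EqNumL κ Φ t p D g f) {Λ : ConcRadiiG}
    (hcolQ : ∀ a x, NrepA κ Φ t p D g f ((fcellsV κ Φ t p D g f c hf).cenS x) + 1 ≤ Λ.rQ a x) :
    ∀ a x, ∃ y ∈ Skelφ.VWin G (fineA κ Φ t p D g f φ') t ((fcellsV κ Φ t p D g f c hf).Q x) (Λ.rQ a x),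
      fineA κ Φ t p D g f φ' y = (fcellsV κ Φ t p D g f c hf).cenS x :=
  fun a x => hcol_fineA_atV κ Φ t p D g f c hf hlip hstep hN x (hcolQ a x)

/-! ## §2 The nine conjuncts for the V cells with small boxes -/

/-- **THE NINE `GeomHoldsN` CONJUNCTS FOR THE V CELLS OF RECORD WITH SMALL BOXES, map slot `φ′`** (`cellGeomSG₂bV … b₀` for any `b₀ ≤ 3r`, any creep / forward-room values `c hf`).
[cite: KozmaNitzan2024, §4 pp. 25–29] -/
theorem geom_fineA_at_bV {φ' : V → Site 2} (hlip : Skelφ.Lip G φ') (hstep : Skelφ.Steps G φ') (hN : EqNumL κ Φ t p D g f) {Λ : ConcRadiiG}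
    (hΛ : Skelφ.WFS2 (fcellsV κ Φ t p D g f c hf).toPCells2 Λ) (hcolQ : ∀ a x, NrepA κ Φ t p D g f ((fcellsV κ Φ t p D g f c hf).cenS x) + 1 ≤ Λ.rQ a x)
    {b₀ : Fin 2 → ℕ} (hb : ∀ i, b₀ i ≤ 3 * (fcellsV κ Φ t p D g f c hf).r i) :
    (Skelφ.cellGeomSG₂bV G (fineA κ Φ t p D g f φ') (fcellsV κ Φ t p D g f c hf) t Λ b₀).root = t ∧
      κ.K₀ ≤ (Skelφ.cellGeomSG₂bV G (fineA κ Φ t p D g f φ') (fcellsV κ Φ t p D g f c hf) t Λ b₀).K ∧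
      Skelφ.Lip G (fineA κ Φ t p D g f φ') ∧
      RunGeom G (Skelφ.cellGeomSG₂bV G (fineA κ Φ t p D g f φ') (fcellsV κ Φ t p D g f c hf) t Λ b₀) ∧
      AnchGeom (Skelφ.cellGeomSG₂bV G (fineA κ Φ t p D g f φ') (fcellsV κ Φ t p D g f c hf) t Λ b₀) ∧
      SepGeom₂ G (Skelφ.cellGeomSG₂bV G (fineA κ Φ t p D g f φ') (fcellsV κ Φ t p D g f c hf) t Λ b₀) ∧
      ExitGeom G (Skelφ.cellGeomSG₂bV G (fineA κ Φ t p D g f φ') (fcellsV κ Φ t p D g f c hf) t Λ b₀) ∧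
      StepsGeom (Skelφ.cellGeomSG₂bV G (fineA κ Φ t p D g f φ') (fcellsV κ Φ t p D g f c hf) t Λ b₀)
        (Skelφ.faceDataSGV G (fineA κ Φ t p D g f φ') (fcellsV κ Φ t p D g f c hf) t Λ) ∧
      LevelGeom G (Skelφ.cellGeomSG₂bV G (fineA κ Φ t p D g f φ') (fcellsV κ Φ t p D g f c hf) t Λ b₀)
        (Skelφ.faceDataSGV G (fineA κ Φ t p D g f φ') (fcellsV κ Φ t p D g f c hf) t Λ)
        (Skelφ.levelDataSV (fineA κ Φ t p D g f φ') (fcellsV κ Φ t p D g f c hf)) := by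
  have hψ0 := fineA_base_at κ Φ t p D g f φ' hN
  have hlipψ := lip_fineA_at κ Φ t p D g f hlip hN
  have hws := weakSteps_fineA_at κ Φ t p D g f hstep hN
  have hcol := hcol_fineA_of_schedV κ Φ t p D g f c hf hlip hstep hN hcolQ
  refine ⟨rfl, (fcellsA_K κ Φ t p D g f).2.1, hlipψ, Skelφ.runGeomSG₂bV _ _ _, Skelφ.anchGeomSG₂bV _ _ _,
    Skelφ.sepGeom₂SG₂bV _ _ _ hΛ hψ0 hlipψ hws hcol, Skelφ.exitGeomSG₂bV _ _ _ hΛ hlipψ hb, Skelφ.stepsGeomSG₂bV _ _ _ hΛ hlipψ hws hb,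
    Skelφ.levelGeomSG₂bV _ _ _ hΛ hlipψ hb⟩

end Geom

end NegB

/-! ## §3 The geometric obligation of the choice function of record under (R-44)/(R-45) -/

/-- **`GeomHoldsNQFn (frmChoiceAllQ3V gv fv Pv Sv cv hv bv)` FOR EVERY SLOT VALUE** — the Geom column obligation of the node theorem at THE CHOICE FUNCTION OF RECORD
(the V scheme over the V cells of record; `bOf ≤ 3r` by `bOf_leV`, the column floor at the staggered centre by `colQ_schedOfT`, the long clause from `FactsNS`). [cite: KozmaNitzan2024, §4 pp. 25–29] -/
theorem geomHoldsNQFn_frmChoiceAllQ3V (gv fv : Neg.FSlot) (Pv : NegB.PSlot) (Sv : NegB.SSlot) (cv hv : NegB.CSlot) (bv : NegB.BSlot) :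
    GeomHoldsNQFn (frmChoiceAllQ3V gv fv Pv Sv cv hv bv) := by
  intro κ V _ _ G _ Φ hg t ht h1 p hp0 hp1 hC O q hAt
  obtain ⟨-, -, hR, -, -⟩ := Skelφ.StepI.OutO.FactsO.shared hAt.1.factsO
  obtain ⟨h1', h2, -, h4, h5, h6, h7, h8, h9⟩ := NegB.geom_fineA_at_bV κ Φ t p O.merged (NegB.gOf κ Φ t p O gv) (NegB.fOf κ Φ t p O fv)
    (NegB.cOf κ Φ t p O gv fv cv) (NegB.hOf κ Φ t p O gv fv hv)
    (NegB.lip_φL κ Φ t p O.D O.DT.toDataN O.ori (NegB.gOf κ Φ t p O gv) (NegB.fOf κ Φ t p O fv))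
    (NegB.steps_φL κ Φ t p O.D O.DT.toDataN O.ori (NegB.gOf κ Φ t p O gv) (NegB.fOf κ Φ t p O fv))
    (NegB.eqNumL_of_factsO κ Φ t p O.D O.DT.toDataN O.ori _ _ hR (Skelφ.StepI.OutO.FactsO.clauses hAt.1.factsO))
    (NegB.schedOfT_WFS2 κ Φ t p O.merged (NegB.gOf κ Φ t p O gv) (NegB.fOf κ Φ t p O fv) (NegB.cOf κ Φ t p O gv fv cv)
      (Sv κ Φ t p O.merged (NegB.gOf κ Φ t p O gv) (NegB.fOf κ Φ t p O fv) q))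
    (NegB.colQ_schedOfT κ Φ t p O.merged (NegB.gOf κ Φ t p O gv) (NegB.fOf κ Φ t p O fv) (NegB.cOf κ Φ t p O gv fv cv)
      (Sv κ Φ t p O.merged (NegB.gOf κ Φ t p O gv) (NegB.fOf κ Φ t p O fv) q))
    (NegB.bOf_leV κ Φ t p O gv fv cv hv bv)
  exact ⟨h1', h2, h4, h5, h6, h7, h8, h9⟩

end PlanarSkeletonFrm

end Summit.CriticalPhenomena.PercolationContinuityZ3.Theorems.Transplant

end
-- build-touch 2026-08-25T06:15:53Z T1-A (lead g18): re-land of p391452, declarations byte-identical
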